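import Literature.Analysis.FluidPDE.PeriodicLerayLimitWeakForm
import Literature.Analysis.FluidPDE.PeriodicLerayMollifiedClasses
import Literature.Analysis.FluidPDE.PeriodicLerayMollifiedDrift
import Literature.Analysis.FluidPDE.PeriodicLerayLimitVelocity
import HarnessLib

/-!
# [BT1] proof of Theorem 2.4 — the periodic weak formulation passes to the Galerkin limit

Analysis/FluidPDE proof file (theorems only; no definitions, no named facts) in the DAG below the
named fact `Literature.Analysis.FluidPDE.bradshawTsai2017_thm_2_4_mollified`
(`PeriodicLerayExistence.lean`; Bradshaw–Tsai, Ann. Henri Poincaré 18 (2017) = arXiv:1510.07504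
[BT1], proof of Thm 2.4, limit `k → ∞` at fixed `ε > 0`: "The limit `U_ε` is a periodic weak
solution of the mollified perturbed Leray system (the weak formulation passes to the limit by
standard arguments, e.g. those in Temam, Ch. III)").

`periodWeakForm_of_limit`: clause (iii) of `IsMollifiedPeriodicWeakSolution.weakForm` — the weak
formulation of the mollified perturbed Leray system against `𝒟_T`, integrated over a period —
holds for a limit `(u, ∇u)` of fields `(U_k, ∇U_k)` which satisfy it eventually (for the given
test field), under: uniform energy bounds `∫|U_k(s)|² ≤ C_E`, uniform gradient bounds over a
period, `U_k → u` in `L²` of the cylinders `Q_n`, `∇U_k ⇀ ∇u` weakly in `L²` of the slabs (the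
output of `PeriodicLerayLimitGradient.exists_gradient_limit`). Every piece of the tested
integrand passes to the limit on `(0,T) × B(0,R_f)` exactly as in
`PeriodicLerayLimitWeakForm.weakForm_limit` (limit `ε → 0`); at fixed `ε` the drift
`η_ε * U_k → η_ε * u` converges in `L²` of the cylinder by the local Young inequality
(`PeriodicLerayMollifiedDrift`), so no `L³` bound is needed.

## References

* Z. Bradshaw, T.-P. Tsai, Ann. Henri Poincaré 18 (2017) = arXiv:1510.07504, proof of Thm 2.4
  [BradshawTsai2017AHP].
* R. Temam, *Navier–Stokes equations* (1977/79), Ch. III §3 [Temam1979].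
-/

noncomputable section

open MeasureTheory Set Function Filter Topology TopologicalSpace Metric ContinuousLinearMap
open scoped NNReal ENNReal InnerProductSpace RealInnerProductSpace

namespace Literature.Analysis.FluidPDE

namespace BradshawTsai2017

section MollifyLocal

variable {η : EuclideanSpace ℝ (Fin 3) → ℝ} {ε : ℝ}

/-- **The local Young inequality for one slice, general scale**: if `η` vanishes outside
`B(0, ρ)` then `∫_{B(0,R)} |η_ε * f|² ≤ ‖η‖₁² ∫_{B(0,R+ερ)} |f|²`. [folklore] -/
theorem setLIntegral_mollify_sq_le_fatten (hη : IsMollifyingKernel η) {ρ : ℝ}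
    (hρ : ∀ y : EuclideanSpace ℝ (Fin 3), ρ ≤ ‖y‖ → η y = 0) (hε : 0 < ε)
    {U : ℝ → EuclideanSpace ℝ (Fin 3) → EuclideanSpace ℝ (Fin 3)} {s : ℝ}
    (hUs : AEStronglyMeasurable (U s) (volume : Measure (EuclideanSpace ℝ (Fin 3)))) (R : ℝ) :
    ∫⁻ y in ball (0 : EuclideanSpace ℝ (Fin 3)) R, ‖mollify η ε U s y‖ₑ ^ (2 : ℝ) ≤
      (∫⁻ y, ‖η y‖ₑ) ^ (2 : ℝ) * ∫⁻ y in ball (0 : EuclideanSpace ℝ (Fin 3)) (R + ε * ρ), ‖U s y‖ₑ ^ (2 : ℝ) := by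
  set V : ℝ → EuclideanSpace ℝ (Fin 3) → EuclideanSpace ℝ (Fin 3) := fun s => (ball (0 : EuclideanSpace ℝ (Fin 3)) (R + ε * ρ)).indicator (U s) with hV
  have hVs : AEStronglyMeasurable (V s) (volume : Measure (EuclideanSpace ℝ (Fin 3))) := hUs.indicator measurableSet_ball
  have hcongr : ∀ y ∈ ball (0 : EuclideanSpace ℝ (Fin 3)) R, mollify η ε U s y = mollify η ε V s y := by
    intro y hy
    refine mollify_apply_congr_of_ball hρ hε fun w hw => ?_
    have hw' : w ∈ ball (0 : EuclideanSpace ℝ (Fin 3)) (R + ε * ρ) := by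
      rw [mem_ball_zero_iff] at hy ⊢
      rw [mem_ball, dist_eq_norm] at hw
      calc ‖w‖ = ‖(w - y) + y‖ := by rw [sub_add_cancel]
        _ ≤ ‖w - y‖ + ‖y‖ := norm_add_le _ _
        _ < ε * ρ + R := by linarith
        _ = R + ε * ρ := add_comm _ _
    rw [hV]; dsimp only; rw [indicator_of_mem hw']
  calc ∫⁻ y in ball (0 : EuclideanSpace ℝ (Fin 3)) R, ‖mollify η ε U s y‖ₑ ^ (2 : ℝ)
      = ∫⁻ y in ball (0 : EuclideanSpace ℝ (Fin 3)) R, ‖mollify η ε V s y‖ₑ ^ (2 : ℝ) := by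
        refine setLIntegral_congr_fun measurableSet_ball fun y hy => ?_
        rw [hcongr y hy]
    _ ≤ ∫⁻ y, ‖mollify η ε V s y‖ₑ ^ (2 : ℝ) := setLIntegral_le_lintegral _ _
    _ ≤ (∫⁻ y, ‖BradshawTsai2019.scaledMollifier η ε y‖ₑ) ^ (2 : ℝ) * ∫⁻ y, ‖V s y‖ₑ ^ (2 : ℝ) :=
        UnboundedOperators.lintegral_rpow_enorm_convolution_le
          (hη.continuous_scaledMollifier ε).aestronglyMeasurable hVs (by norm_num)
    _ = (∫⁻ y, ‖η y‖ₑ) ^ (2 : ℝ) * ∫⁻ y in ball (0 : EuclideanSpace ℝ (Fin 3)) (R + ε * ρ), ‖U s y‖ₑ ^ (2 : ℝ) := by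
        rw [hη.lintegral_enorm_scaledMollifier hε, ← lintegral_indicator measurableSet_ball]
        congr 1
        refine lintegral_congr fun y => ?_
        rw [hV]
        dsimp only
        by_cases hy : y ∈ ball (0 : EuclideanSpace ℝ (Fin 3)) (R + ε * ρ)
        · rw [indicator_of_mem hy, indicator_of_mem hy]
        · rw [indicator_of_notMem hy, indicator_of_notMem hy, enorm_zero,
            ENNReal.zero_rpow_of_pos (by norm_num)]

/-- **The local Young inequality on cylinders, general scale**:
`∫∫_{S×B(0,R)} |η_ε * U|² ≤ ‖η‖₁² ∫∫_{S×B(0,R+ερ)} |U|²` for a jointly measurable `U` with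
measurable slices. [folklore] -/
theorem setLIntegral_cylinder_mollify_sq_le_fatten (hη : IsMollifyingKernel η) {ρ : ℝ}
    (hρ : ∀ y : EuclideanSpace ℝ (Fin 3), ρ ≤ ‖y‖ → η y = 0) (hε : 0 < ε)
    {U : ℝ → EuclideanSpace ℝ (Fin 3) → EuclideanSpace ℝ (Fin 3)}
    (hUm : AEStronglyMeasurable (uncurry U) (volume : Measure (ℝ × EuclideanSpace ℝ (Fin 3))))
    (hUs : ∀ᵐ s : ℝ, AEStronglyMeasurable (U s) (volume : Measure (EuclideanSpace ℝ (Fin 3)))) (S : Set ℝ) (R : ℝ) :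
    ∫⁻ z in S ×ˢ ball (0 : EuclideanSpace ℝ (Fin 3)) R, ‖mollify η ε U z.1 z.2‖ₑ ^ (2 : ℝ) ≤
      (∫⁻ y, ‖η y‖ₑ) ^ (2 : ℝ) * ∫⁻ z in S ×ˢ ball (0 : EuclideanSpace ℝ (Fin 3)) (R + ε * ρ), ‖U z.1 z.2‖ₑ ^ (2 : ℝ) := by
  have hmm : AEStronglyMeasurable (fun z : ℝ × EuclideanSpace ℝ (Fin 3) => mollify η ε U z.1 z.2) (volume : Measure (ℝ × EuclideanSpace ℝ (Fin 3))) :=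
    hη.aestronglyMeasurable_mollify ε hUm
  have hUm' : AEStronglyMeasurable (fun z : ℝ × EuclideanSpace ℝ (Fin 3) => U z.1 z.2) (volume : Measure (ℝ × EuclideanSpace ℝ (Fin 3))) := hUm
  rw [setLIntegral_prod_enorm_rpow_eq (F := fun z : ℝ × EuclideanSpace ℝ (Fin 3) => mollify η ε U z.1 z.2) hmm (2 : ℝ) S _,
    setLIntegral_prod_enorm_rpow_eq (F := fun z : ℝ × EuclideanSpace ℝ (Fin 3) => U z.1 z.2) hUm' (2 : ℝ) S _,
    ← lintegral_const_mul' _ _ (ENNReal.rpow_ne_top_of_nonneg (by norm_num) hη.lintegral_enorm_lt_top.ne)]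
  dsimp only
  refine lintegral_mono_ae ?_
  filter_upwards [ae_restrict_of_ae hUs] with s hs
  exact setLIntegral_mollify_sq_le_fatten hη hρ hε hs R

/-- **The mollification at a fixed scale is continuous along `L²_loc`-convergent sequences**:
if `U_k → u` in `L²` of every cylinder `Q_n = (−n−1,n+1) × B(0,n+1)` (slices of `U_k` in
`L²`, slices of `u` in `L²` for a.e. time), then `η_ε * U_k → η_ε * u` in `L²` of every
cylinder `(a,b) × B(0,R)`. [folklore] -/
theorem tendsto_eLpNorm_mollify_sub_of_cylinders (hη : IsMollifyingKernel η) (hε : 0 < ε)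
    {U : ℕ → ℝ → EuclideanSpace ℝ (Fin 3) → EuclideanSpace ℝ (Fin 3)} {u : ℝ → EuclideanSpace ℝ (Fin 3) → EuclideanSpace ℝ (Fin 3)}
    (hUm : ∀ k, AEStronglyMeasurable (uncurry (U k)) (volume : Measure (ℝ × EuclideanSpace ℝ (Fin 3))))
    (hum : AEStronglyMeasurable (uncurry u) (volume : Measure (ℝ × EuclideanSpace ℝ (Fin 3))))
    (hUs : ∀ k s, MemLp (U k s) 2 (volume : Measure (EuclideanSpace ℝ (Fin 3))))
    (hus : ∀ᵐ s : ℝ, MemLp (u s) 2 (volume : Measure (EuclideanSpace ℝ (Fin 3))))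
    (hconv : ∀ n : ℕ, Tendsto (fun k => ∫⁻ z in Ioo (-((n : ℝ) + 1)) ((n : ℝ) + 1) ×ˢ
        ball (0 : EuclideanSpace ℝ (Fin 3)) (n + 1), ‖U k z.1 z.2 - u z.1 z.2‖ₑ ^ 2) atTop (𝓝 0))
    (a b R : ℝ) :
    Tendsto (fun k => eLpNorm ((fun z : ℝ × EuclideanSpace ℝ (Fin 3) => mollify η ε (U k) z.1 z.2) -
      fun z => mollify η ε u z.1 z.2) 2 (volume.restrict (Ioo a b ×ˢ ball (0 : EuclideanSpace ℝ (Fin 3)) R))) atTop (𝓝 0) := by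
  obtain ⟨ρ, hρ0, hρ⟩ := hη.exists_support_radius
  set V : ℕ → ℝ → EuclideanSpace ℝ (Fin 3) → EuclideanSpace ℝ (Fin 3) := fun k s y => U k s y - u s y with hV
  have hVm : ∀ k, AEStronglyMeasurable (uncurry (V k)) (volume : Measure (ℝ × EuclideanSpace ℝ (Fin 3))) := fun k => (hUm k).sub hum
  have hVs : ∀ k, ∀ᵐ s : ℝ, AEStronglyMeasurable (V k s) (volume : Measure (EuclideanSpace ℝ (Fin 3))) := fun k => by
    filter_upwards [hus] with s hs
    exact (hUs k s).1.sub hs.1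
  -- the a.e. identity `η_ε * U_k − η_ε * u = η_ε * (U_k − u)`
  have hae : ∀ k, (fun z : ℝ × EuclideanSpace ℝ (Fin 3) => mollify η ε (U k) z.1 z.2 - mollify η ε u z.1 z.2) =ᵐ[volume]
      fun z => mollify η ε (V k) z.1 z.2 := by
    intro k
    have hs : ∀ᵐ s : ℝ, ∀ y, mollify η ε (U k) s y - mollify η ε u s y = mollify η ε (V k) s y := by
      filter_upwards [hus] with s hs y
      rw [hV]
      exact (mollify_sub_apply hη hε (hUs k s) hs y).symm
    have h := (Measure.quasiMeasurePreserving_fst (μ := (volume : Measure ℝ))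
      (ν := (volume : Measure (EuclideanSpace ℝ (Fin 3))))).ae hs
    rw [← Measure.volume_eq_prod] at h
    filter_upwards [h] with z hz
    exact hz z.2
  -- a big cylinder containing the fattened one
  set n : ℕ := ⌈max (max |a| |b|) (R + ε * ρ)⌉₊ with hn
  have hn1 : max (max |a| |b|) (R + ε * ρ) ≤ (n : ℝ) := Nat.le_ceil _
  have hsub : Ioo a b ×ˢ ball (0 : EuclideanSpace ℝ (Fin 3)) (R + ε * ρ) ⊆
      Ioo (-((n : ℝ) + 1)) ((n : ℝ) + 1) ×ˢ ball (0 : EuclideanSpace ℝ (Fin 3)) (n + 1) := by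
    refine prod_mono (fun t ht => ⟨?_, ?_⟩) (ball_subset_ball (by linarith [le_max_right (max |a| |b|) (R + ε * ρ)]))
    · have := ht.1; linarith [neg_abs_le a, le_max_left |a| |b|, le_max_left (max |a| |b|) (R + ε * ρ)]
    · have := ht.2; linarith [le_abs_self b, le_max_right |a| |b|, le_max_left (max |a| |b|) (R + ε * ρ)]
  -- the bound and the squeeze
  have hbd : ∀ k, ∫⁻ z in Ioo a b ×ˢ ball (0 : EuclideanSpace ℝ (Fin 3)) R,
      ‖(fun z : ℝ × EuclideanSpace ℝ (Fin 3) => mollify η ε (U k) z.1 z.2) z - (fun z : ℝ × EuclideanSpace ℝ (Fin 3) => mollify η ε u z.1 z.2) z‖ₑ ^ 2 ≤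
      (∫⁻ y, ‖η y‖ₑ) ^ (2 : ℝ) * ∫⁻ z in Ioo (-((n : ℝ) + 1)) ((n : ℝ) + 1) ×ˢ ball (0 : EuclideanSpace ℝ (Fin 3)) (n + 1),
        ‖U k z.1 z.2 - u z.1 z.2‖ₑ ^ 2 := by
    intro k
    calc ∫⁻ z in Ioo a b ×ˢ ball (0 : EuclideanSpace ℝ (Fin 3)) R,
          ‖(fun z : ℝ × EuclideanSpace ℝ (Fin 3) => mollify η ε (U k) z.1 z.2) z - (fun z : ℝ × EuclideanSpace ℝ (Fin 3) => mollify η ε u z.1 z.2) z‖ₑ ^ 2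
        = ∫⁻ z in Ioo a b ×ˢ ball (0 : EuclideanSpace ℝ (Fin 3)) R, ‖mollify η ε (V k) z.1 z.2‖ₑ ^ (2 : ℝ) := by
          refine lintegral_congr_ae ?_
          filter_upwards [ae_restrict_of_ae (hae k)] with z hz
          rw [← ENNReal.rpow_two]
          exact congrArg (fun w => (‖w‖ₑ : ℝ≥0∞) ^ (2 : ℝ)) hz
      _ ≤ (∫⁻ y, ‖η y‖ₑ) ^ (2 : ℝ) * ∫⁻ z in Ioo a b ×ˢ ball (0 : EuclideanSpace ℝ (Fin 3)) (R + ε * ρ), ‖V k z.1 z.2‖ₑ ^ (2 : ℝ) :=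
          setLIntegral_cylinder_mollify_sq_le_fatten hη hρ hε (hVm k) (hVs k) _ _
      _ ≤ (∫⁻ y, ‖η y‖ₑ) ^ (2 : ℝ) * ∫⁻ z in Ioo (-((n : ℝ) + 1)) ((n : ℝ) + 1) ×ˢ ball (0 : EuclideanSpace ℝ (Fin 3)) (n + 1),
            ‖U k z.1 z.2 - u z.1 z.2‖ₑ ^ 2 := by
          refine mul_le_mul' le_rfl ((lintegral_mono_set hsub).trans (le_of_eq (lintegral_congr fun z => ?_)))
          rw [hV, ENNReal.rpow_two]
  have hlim : Tendsto (fun k => (∫⁻ y, ‖η y‖ₑ) ^ (2 : ℝ) *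
      ∫⁻ z in Ioo (-((n : ℝ) + 1)) ((n : ℝ) + 1) ×ˢ ball (0 : EuclideanSpace ℝ (Fin 3)) (n + 1), ‖U k z.1 z.2 - u z.1 z.2‖ₑ ^ 2)
      atTop (𝓝 0) := by
    have h := ENNReal.Tendsto.const_mul (hconv n) (a := (∫⁻ y, ‖η y‖ₑ) ^ (2 : ℝ))
      (Or.inr (ENNReal.rpow_ne_top_of_nonneg (by norm_num) hη.lintegral_enorm_lt_top.ne))
    rwa [mul_zero] at h
  exact FunctionSpaces.tendsto_eLpNorm_two_of_tendsto_lintegral_sq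
    (tendsto_of_tendsto_of_tendsto_of_le_of_le tendsto_const_nhds hlim (fun _ => zero_le) hbd)

end MollifyLocal

section GalerkinWeakFormLimit

set_option maxHeartbeats 1600000 in
/-- **The periodic weak formulation passes to the Galerkin limit** ([BT1], proof of Thm 2.4,
limit `k → ∞`; Temam Ch. III §3). See the module docstring. [cite: BradshawTsai2017AHP, proof of Thm 2.4 (limit k → ∞)] -/
theorem periodWeakForm_of_limit {T : ℝ} (hT : 0 < T)
    {W : ℝ → EuclideanSpace ℝ (Fin 3) → EuclideanSpace ℝ (Fin 3)} (hW : ContDiff ℝ 1 (uncurry W))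
    {η : EuclideanSpace ℝ (Fin 3) → ℝ} (hη : IsMollifyingKernel η) {ε : ℝ} (hε : 0 < ε)
    {U : ℕ → ℝ → EuclideanSpace ℝ (Fin 3) → EuclideanSpace ℝ (Fin 3)}
    (hUm : ∀ k, AEStronglyMeasurable (uncurry (U k)) (volume : Measure (ℝ × EuclideanSpace ℝ (Fin 3))))
    (hUs : ∀ k s, AEStronglyMeasurable (U k s) (volume : Measure (EuclideanSpace ℝ (Fin 3))))
    {CE : ℝ≥0} (hUE : ∀ k s, ∫⁻ y, ‖U k s y‖ₑ ^ 2 ≤ CE)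
    {G : ℕ → ℝ → EuclideanSpace ℝ (Fin 3) → EuclideanSpace ℝ (Fin 3) →L[ℝ] EuclideanSpace ℝ (Fin 3)}
    (hGg : ∀ k, HasWeakSpatialGradientOn (⊤ : Opens (ℝ × EuclideanSpace ℝ (Fin 3))) (U k) (G k))
    {CG : ℝ≥0} (hGb : ∀ k, ∫⁻ z in Ioo 0 T ×ˢ (univ : Set (EuclideanSpace ℝ (Fin 3))),
      ENNReal.ofReal (frobeniusNormSq (G k z.1 z.2)) ≤ CG)
    {Ul : ℝ → EuclideanSpace ℝ (Fin 3) → EuclideanSpace ℝ (Fin 3)}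
    (hUlm : AEStronglyMeasurable (uncurry Ul) (volume : Measure (ℝ × EuclideanSpace ℝ (Fin 3))))
    (huE : ∀ n : ℕ, ∀ᵐ t ∂(volume.restrict (Ioo (-((n : ℝ) + 1)) ((n : ℝ) + 1))),
      ∫⁻ x in ball (0 : EuclideanSpace ℝ (Fin 3)) (n + 1), ‖Ul t x‖ₑ ^ 2 ≤ CE)
    (hconv : ∀ n : ℕ, Tendsto (fun k => ∫⁻ z in Ioo (-((n : ℝ) + 1)) ((n : ℝ) + 1) ×ˢ
        ball (0 : EuclideanSpace ℝ (Fin 3)) (n + 1), ‖U k z.1 z.2 - Ul z.1 z.2‖ₑ ^ 2) atTop (𝓝 0))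
    {Gu : ℝ → EuclideanSpace ℝ (Fin 3) → EuclideanSpace ℝ (Fin 3) →L[ℝ] EuclideanSpace ℝ (Fin 3)}
    (hGu : HasWeakSpatialGradientOn (⊤ : Opens (ℝ × EuclideanSpace ℝ (Fin 3))) Ul Gu)
    (hGub : ∀ m : ℕ, ∫⁻ z in Ioo (-((m : ℝ) + 1)) ((m : ℝ) + 1) ×ˢ (univ : Set (EuclideanSpace ℝ (Fin 3))),
      ENNReal.ofReal (frobeniusNormSq (Gu z.1 z.2)) < ∞)
    (hGw : ∀ (m : ℕ) (a : EuclideanSpace ℝ (Fin 3)) (h : ℝ × EuclideanSpace ℝ (Fin 3) → EuclideanSpace ℝ (Fin 3)),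
      MemLp h 2 (volume.restrict (Ioo (-((m : ℝ) + 1)) ((m : ℝ) + 1) ×ˢ (univ : Set (EuclideanSpace ℝ (Fin 3))))) →
      Tendsto (fun k => ∫ z in Ioo (-((m : ℝ) + 1)) ((m : ℝ) + 1) ×ˢ (univ : Set (EuclideanSpace ℝ (Fin 3))),
          ⟪G k z.1 z.2 a, h z⟫) atTop
        (𝓝 (∫ z in Ioo (-((m : ℝ) + 1)) ((m : ℝ) + 1) ×ˢ (univ : Set (EuclideanSpace ℝ (Fin 3))), ⟪Gu z.1 z.2 a, h z⟫)))
    {f : ℝ → EuclideanSpace ℝ (Fin 3) → EuclideanSpace ℝ (Fin 3)} (hf : IsPeriodicDivFreeTest T f)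
    (hid : ∀ᶠ k in atTop,
      ∫ s in Ioo 0 T, ((∫ y, (⟪U k s y, timeDeriv f s y⟫ -
          frobeniusInner (G k s y) (fderiv ℝ (f s) y) +
          ⟪U k s y + G k s y y - G k s y (W s y + mollify η ε (U k) s y) -
            fderiv ℝ (W s) y (U k s y) - fderiv ℝ (W s) y (W s y), f s y⟫)) -
        lerayPairing W s (f s)) = 0) :
    ∫ s in Ioo 0 T, ((∫ y, (⟪Ul s y, timeDeriv f s y⟫ -
        frobeniusInner (Gu s y) (fderiv ℝ (f s) y) +
        ⟪Ul s y + Gu s y y - Gu s y (W s y + mollify η ε Ul s y) -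
          fderiv ℝ (W s) y (Ul s y) - fderiv ℝ (W s) y (W s y), f s y⟫)) -
      lerayPairing W s (f s)) = 0 := by
  have happ : Continuous (uncurry fun (L : EuclideanSpace ℝ (Fin 3) →L[ℝ] EuclideanSpace ℝ (Fin 3)) (v : EuclideanSpace ℝ (Fin 3)) => L v) :=
    isBoundedBilinearMap_apply.continuous
  -- ## the test field: support, continuity, periodicity and bounds of the weights
  have hf1 : ContDiff ℝ 1 (uncurry f) := hf.contDiff.of_le (by exact_mod_cast le_top)
  obtain ⟨Rf, hRf0, hRf⟩ := hf.exists_ball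
  have cf : Continuous fun z : ℝ × EuclideanSpace ℝ (Fin 3) => f z.1 z.2 := hf1.continuous
  have cft : Continuous fun z : ℝ × EuclideanSpace ℝ (Fin 3) => timeDeriv f z.1 z.2 := continuous_timeDeriv_of_contDiff_one hf1
  have cDf : Continuous fun z : ℝ × EuclideanSpace ℝ (Fin 3) => fderiv ℝ (f z.1) z.2 := continuous_fderiv_slice_of_contDiff hf1
  have hftper : ∀ s y, timeDeriv f (s + T) y = timeDeriv f s y := by
    intro s y
    have h := deriv_comp_add_const (f := fun τ => f τ y) (a := T) (x := s)
    simp only [hf.periodic] at h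
    rw [timeDeriv, timeDeriv]
    exact h.symm
  have hDfper : ∀ s y, fderiv ℝ (f (s + T)) y = fderiv ℝ (f s) y := by
    intro s y; rw [show f (s + T) = f s from funext (hf.periodic s)]
  obtain ⟨Cf, hCf0, hCf⟩ := exists_global_bound_of_periodic cf hT (fun s y => hf.periodic s y)
    (fun z hz => (hRf z.1 z.2 hz).1)
  obtain ⟨Cft, hCft0, hCft⟩ := exists_global_bound_of_periodic cft hT hftper (fun z hz => (hRf z.1 z.2 hz).2.2)
  obtain ⟨CDf, hCDf0, hCDf⟩ := exists_global_bound_of_periodic cDf hT hDfper (fun z hz => (hRf z.1 z.2 hz).2.1)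
  -- ## the cylinder `(0,T) × B(0,R_f)` and the comparison cylinders
  set I : Set ℝ := Ioo 0 T with hI
  set B : Set (EuclideanSpace ℝ (Fin 3)) := ball (0 : EuclideanSpace ℝ (Fin 3)) Rf with hB
  set S : Set (ℝ × EuclideanSpace ℝ (Fin 3)) := I ×ˢ B with hS
  have hSm : MeasurableSet S := measurableSet_Ioo.prod measurableSet_ball
  haveI hfinQ : IsFiniteMeasure (volume.restrict S) :=
    NSCylinder.isFiniteMeasure_restrict (Ω := ⟨ball (0 : EuclideanSpace ℝ (Fin 3)) Rf, isOpen_ball⟩) isBounded_ball 0 T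
  set μQ : Measure (ℝ × EuclideanSpace ℝ (Fin 3)) := volume.restrict S with hμQ
  set n : ℕ := ⌈max T Rf⌉₊ with hn
  have hTn : T ≤ (n : ℝ) + 1 := ((le_max_left T Rf).trans (Nat.le_ceil _)).trans (le_add_of_nonneg_right zero_le_one)
  have hRn : Rf ≤ (n : ℝ) + 1 := ((le_max_right T Rf).trans (Nat.le_ceil _)).trans (le_add_of_nonneg_right zero_le_one)
  have hSQ : S ⊆ Ioo (-((n : ℝ) + 1)) ((n : ℝ) + 1) ×ˢ ball (0 : EuclideanSpace ℝ (Fin 3)) (n + 1) := fun z hz =>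
    ⟨⟨by linarith [hz.1.1, (Nat.cast_nonneg n : (0 : ℝ) ≤ n)], hz.1.2.trans_le hTn⟩, ball_subset_ball hRn hz.2⟩
  have hSslab : S ⊆ Ioo (-((n : ℝ) + 1)) ((n : ℝ) + 1) ×ˢ (univ : Set (EuclideanSpace ℝ (Fin 3))) := fun z hz =>
    ⟨(hSQ hz).1, mem_univ _⟩
  -- ## the profile on the cylinder
  obtain ⟨M, hM0, hMW, -⟩ := exists_profile_bound hW 0 T (0 : EuclideanSpace ℝ (Fin 3)) Rf
  have hWc : Continuous (uncurry W) := hW.continuous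
  have cW : Continuous fun z : ℝ × EuclideanSpace ℝ (Fin 3) => W z.1 z.2 := hWc
  have cDW : Continuous fun z : ℝ × EuclideanSpace ℝ (Fin 3) => fderiv ℝ (W z.1) z.2 := continuous_fderiv_slice_of_contDiff hW
  obtain ⟨M₂, hM₂⟩ := ((isCompact_Icc (a := (0 : ℝ)) (b := T)).prod
    (isCompact_closedBall (0 : EuclideanSpace ℝ (Fin 3)) Rf)).exists_bound_of_continuousOn cDW.continuousOn
  set MD : ℝ := max M₂ 0 with hMD
  have hMD0 : 0 ≤ MD := le_max_right _ _
  have hMDW : ∀ s ∈ Icc 0 T, ∀ y ∈ closedBall (0 : EuclideanSpace ℝ (Fin 3)) Rf, ‖fderiv ℝ (W s) y‖ ≤ MD :=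
    fun s hs y hy => (hM₂ (s, y) ⟨hs, hy⟩).trans (le_max_left _ _)
  have hWm : AEStronglyMeasurable (fun z : ℝ × EuclideanSpace ℝ (Fin 3) => W z.1 z.2) μQ := cW.aestronglyMeasurable.restrict
  have hWbd : ∀ᵐ z ∂μQ, ‖W z.1 z.2‖ ≤ M := by
    filter_upwards [ae_restrict_mem hSm] with z hz
    exact hMW z.1 (Ioo_subset_Icc_self hz.1) z.2 (ball_subset_closedBall hz.2)
  have hWmem : MemLp (fun z : ℝ × EuclideanSpace ℝ (Fin 3) => W z.1 z.2) 2 μQ := (memLp_top_of_bound hWm M hWbd).mono_exponent le_top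
  -- the truncated slice derivative of the profile (bounded everywhere)
  set L : ℝ × EuclideanSpace ℝ (Fin 3) → EuclideanSpace ℝ (Fin 3) →L[ℝ] EuclideanSpace ℝ (Fin 3) :=
    S.indicator fun z => fderiv ℝ (W z.1) z.2 with hL
  have hLm : AEStronglyMeasurable L μQ := (cDW.aestronglyMeasurable.indicator hSm).restrict
  have hLM : ∀ z, ‖L z‖ ≤ MD := by
    intro z
    by_cases hz : z ∈ S
    · rw [hL, indicator_of_mem hz]
      exact hMDW z.1 (Ioo_subset_Icc_self hz.1) z.2 (ball_subset_closedBall hz.2)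
    · rw [hL, indicator_of_notMem hz, norm_zero]; exact hMD0
  have hLae : ∀ᵐ z ∂μQ, L z = fderiv ℝ (W z.1) z.2 := by
    filter_upwards [ae_restrict_mem hSm] with z hz
    rw [hL, indicator_of_mem hz]
  -- ## classes and convergences of the velocities on the cylinder
  -- (measurability of the `U k` is a hypothesis)
  have hSslab0 : S ⊆ Icc 0 T ×ˢ (univ : Set (EuclideanSpace ℝ (Fin 3))) := fun z hz => ⟨Ioo_subset_Icc_self hz.1, mem_univ _⟩
  have hUslab : ∀ k (a b : ℝ), MemLp (uncurry (U k)) 2 (volume.restrict (Icc a b ×ˢ (univ : Set (EuclideanSpace ℝ (Fin 3))))) :=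
    fun k => memLp_slab_of_forall_lintegral_le (hUm k) two_ne_zero ENNReal.ofNat_ne_top ENNReal.coe_ne_top
      (fun s => by rw [ENNReal.toReal_ofNat]; exact_mod_cast hUE k s)
  have hUmem : ∀ k, MemLp (fun z : ℝ × EuclideanSpace ℝ (Fin 3) => U k z.1 z.2) 2 μQ := fun k =>
    (hUslab k 0 T).mono_measure (Measure.restrict_mono hSslab0 le_rfl)
  -- generic: bounded measurable fields are in `L²(μQ)`
  have hbdmem' : ∀ {c : ℝ × EuclideanSpace ℝ (Fin 3) → EuclideanSpace ℝ (Fin 3)} {K : ℝ}, AEStronglyMeasurable c μQ →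
      (∀ᵐ z ∂μQ, ‖c z‖ ≤ K) → MemLp c 2 μQ := fun {c K} hc hK => (memLp_top_of_bound hc K hK).mono_exponent le_top
  -- the mollified fields are bounded
  set Kη : ℝ := (eLpNorm (BradshawTsai2019.scaledMollifier η ε) 2 (volume : Measure (EuclideanSpace ℝ (Fin 3))) *
    (CE : ℝ≥0∞) ^ (1 / 2 : ℝ)).toReal with hKη
  have hmbd : ∀ k s y, ‖mollify η ε (U k) s y‖ ≤ Kη := fun k s y =>
    norm_mollify_le_of_energy hη hε (hUs k s) (hUE k s) y
  have hmmem : ∀ k, MemLp (fun z : ℝ × EuclideanSpace ℝ (Fin 3) => mollify η ε (U k) z.1 z.2) 2 μQ := fun k =>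
    hbdmem' (hη.aestronglyMeasurable_mollify ε (hUm k)).restrict (ae_of_all _ fun z => hmbd k z.1 z.2)
  have hUfin : ∀ k (m : ℕ), ∫⁻ z in Ioo (-((m : ℝ) + 1)) ((m : ℝ) + 1) ×ˢ ball (0 : EuclideanSpace ℝ (Fin 3)) (m + 1),
      ‖U k z.1 z.2‖ₑ ^ 2 < ∞ := by
    intro k m
    have h := (hUslab k (-((m : ℝ) + 1)) ((m : ℝ) + 1)).2
    rw [FunctionSpaces.AubinLions.eLpNorm_two_eq_rpow] at h
    have h' := (ENNReal.rpow_lt_top_iff_of_pos (by norm_num : (0:ℝ) < 1 / 2)).1 h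
    exact lt_of_le_of_lt (lintegral_mono_set (prod_mono Ioo_subset_Icc_self (subset_univ _))) h'
  obtain ⟨hUlQ, -⟩ := locallyIntegrable_of_cylinder_limit (V := U) hUm hUfin hUlm hconv
  have hUlmem : MemLp (fun z : ℝ × EuclideanSpace ℝ (Fin 3) => Ul z.1 z.2) 2 μQ := by
    refine ⟨hUlm.restrict, ?_⟩
    rw [FunctionSpaces.AubinLions.eLpNorm_two_eq_rpow]
    exact ENNReal.rpow_lt_top_of_nonneg (by norm_num) (((lintegral_mono_set hSQ).trans_lt (hUlQ n)).ne)
  -- slices of the limit are in `L²` for a.e. `s`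
  have hUlE : ∀ᵐ s : ℝ, ∫⁻ y, ‖Ul s y‖ₑ ^ 2 ≤ CE := ae_lintegral_sq_le_of_forall_ball huE
  have hUls : ∀ᵐ s : ℝ, AEStronglyMeasurable (Ul s) (volume : Measure (EuclideanSpace ℝ (Fin 3))) := by
    have h := FunctionSpaces.AubinLions.ae_aestronglyMeasurable_slice (I := univ) (O := univ) (f := uncurry Ul)
      (by rw [univ_prod_univ, Measure.restrict_univ]; exact hUlm)
    simp only [Measure.restrict_univ] at h
    filter_upwards [h] with s hs
    exact hs
  have hUlmem2 : ∀ᵐ s : ℝ, MemLp (Ul s) 2 (volume : Measure (EuclideanSpace ℝ (Fin 3))) := by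
    filter_upwards [hUls, hUlE] with s hs hE
    refine ⟨hs, ?_⟩
    rw [FunctionSpaces.AubinLions.eLpNorm_two_eq_rpow]
    exact ENNReal.rpow_lt_top_of_nonneg (by norm_num) (hE.trans_lt ENNReal.coe_lt_top).ne
  have hmlbd : ∀ᵐ z ∂μQ, ‖mollify η ε Ul z.1 z.2‖ ≤ Kη := by
    have hs : ∀ᵐ s : ℝ, ∀ y, ‖mollify η ε Ul s y‖ ≤ Kη := by
      filter_upwards [hUls, hUlE] with s hs hE y
      exact norm_mollify_le_of_energy hη hε hs hE y
    have h := (Measure.quasiMeasurePreserving_fst (μ := (volume : Measure ℝ))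
      (ν := (volume : Measure (EuclideanSpace ℝ (Fin 3))))).ae hs
    rw [← Measure.volume_eq_prod] at h
    exact ae_restrict_of_ae (h.mono fun z hz => hz z.2)
  have hmlmem : MemLp (fun z : ℝ × EuclideanSpace ℝ (Fin 3) => mollify η ε Ul z.1 z.2) 2 μQ :=
    hbdmem' (hη.aestronglyMeasurable_mollify ε hUlm).restrict hmlbd
  have hbkmem : ∀ k, MemLp (fun z : ℝ × EuclideanSpace ℝ (Fin 3) => W z.1 z.2 + mollify η ε (U k) z.1 z.2) 2 μQ :=
    fun k => hWmem.add (hmmem k)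
  have hbmem : MemLp (fun z : ℝ × EuclideanSpace ℝ (Fin 3) => W z.1 z.2 + mollify η ε Ul z.1 z.2) 2 μQ := hWmem.add hmlmem
  have hfmem : MemLp (fun z : ℝ × EuclideanSpace ℝ (Fin 3) => f z.1 z.2) 2 μQ :=
    (memLp_top_of_bound cf.aestronglyMeasurable.restrict Cf (Eventually.of_forall hCf)).mono_exponent le_top
  have hconvU : Tendsto (fun k => eLpNorm ((fun z : ℝ × EuclideanSpace ℝ (Fin 3) => U k z.1 z.2) - fun z => Ul z.1 z.2) 2 μQ)
      atTop (𝓝 0) := by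
    refine FunctionSpaces.tendsto_eLpNorm_two_of_tendsto_lintegral_sq (f := fun k => uncurry (U k)) (g := uncurry Ul) ?_
    exact tendsto_of_tendsto_of_tendsto_of_le_of_le tendsto_const_nhds (hconv n) (fun _ => zero_le)
      fun k => lintegral_mono_set hSQ
  have hUks : ∀ k s, MemLp (U k s) 2 (volume : Measure (EuclideanSpace ℝ (Fin 3))) := fun k s => by
    refine ⟨hUs k s, ?_⟩
    rw [FunctionSpaces.AubinLions.eLpNorm_two_eq_rpow]
    exact ENNReal.rpow_lt_top_of_nonneg (by norm_num) ((hUE k s).trans_lt ENNReal.coe_lt_top).ne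
  have hconvm : Tendsto (fun k => eLpNorm ((fun z : ℝ × EuclideanSpace ℝ (Fin 3) => mollify η ε (U k) z.1 z.2) -
      fun z => mollify η ε Ul z.1 z.2) 2 μQ) atTop (𝓝 0) :=
    tendsto_eLpNorm_mollify_sub_of_cylinders hη hε hUm hUlm hUks hUlmem2 hconv 0 T Rf
  have hconvb : Tendsto (fun k => eLpNorm ((fun z : ℝ × EuclideanSpace ℝ (Fin 3) => W z.1 z.2 + mollify η ε (U k) z.1 z.2) -
      fun z => W z.1 z.2 + mollify η ε Ul z.1 z.2) 2 μQ) atTop (𝓝 0) := by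
    refine hconvm.congr fun k => ?_
    congr 1; funext z; simp only [Pi.sub_apply]; abel
  have hconvf : Tendsto (fun _ : ℕ => eLpNorm ((fun z : ℝ × EuclideanSpace ℝ (Fin 3) => f z.1 z.2) -
      fun z => f z.1 z.2) 2 μQ) atTop (𝓝 0) := by
    simp only [sub_self, eLpNorm_zero]; exact tendsto_const_nhds
  -- ## the gradients on the cylinder: columns, bounds, weak convergence
  have hGm : ∀ k, AEStronglyMeasurable (fun z : ℝ × EuclideanSpace ℝ (Fin 3) => G k z.1 z.2)
      (volume : Measure (ℝ × EuclideanSpace ℝ (Fin 3))) := by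
    intro k
    have h1 := (hGg k).locallyIntegrableOn_grad.aestronglyMeasurable
    rwa [Opens.coe_top, Measure.restrict_univ] at h1
  have hGum : AEStronglyMeasurable (fun z : ℝ × EuclideanSpace ℝ (Fin 3) => Gu z.1 z.2)
      (volume : Measure (ℝ × EuclideanSpace ℝ (Fin 3))) := by
    have h1 := hGu.locallyIntegrableOn_grad.aestronglyMeasurable
    rwa [Opens.coe_top, Measure.restrict_univ] at h1
  have hcolm : ∀ {Γ : ℝ × EuclideanSpace ℝ (Fin 3) → EuclideanSpace ℝ (Fin 3) →L[ℝ] EuclideanSpace ℝ (Fin 3)},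
      AEStronglyMeasurable Γ (volume : Measure (ℝ × EuclideanSpace ℝ (Fin 3))) → ∀ a : EuclideanSpace ℝ (Fin 3),
      AEStronglyMeasurable (fun z => Γ z a) μQ := fun hΓ a =>
    (happ.comp_aestronglyMeasurable₂ hΓ aestronglyMeasurable_const).restrict
  -- `∫_S ‖Γ eᵢ‖² ≤ ∫_S' |Γ|²_F` for `S ⊆ S'`
  have hcol2 : ∀ {Γ : ℝ × EuclideanSpace ℝ (Fin 3) → EuclideanSpace ℝ (Fin 3) →L[ℝ] EuclideanSpace ℝ (Fin 3)}
      {S' : Set (ℝ × EuclideanSpace ℝ (Fin 3))}, S ⊆ S' → ∀ i,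
      eLpNorm (fun z => Γ z (stdOrthonormalBasis ℝ (EuclideanSpace ℝ (Fin 3)) i)) 2 μQ ≤
        (∫⁻ z in S', ENNReal.ofReal (frobeniusNormSq (Γ z))) ^ (1 / 2 : ℝ) := by
    intro Γ S' hSS' i
    rw [FunctionSpaces.AubinLions.eLpNorm_two_eq_rpow]
    refine ENNReal.rpow_le_rpow ((lintegral_mono fun z => ?_).trans (lintegral_mono_set hSS')) (by norm_num)
    rw [← ofReal_norm, ← ENNReal.ofReal_pow (norm_nonneg _)]
    exact ENNReal.ofReal_le_ofReal (norm_apply_basis_sq_le_frobeniusNormSq _ _)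
  have hGcol : ∀ k i, eLpNorm (fun z : ℝ × EuclideanSpace ℝ (Fin 3) => G k z.1 z.2 (stdOrthonormalBasis ℝ (EuclideanSpace ℝ (Fin 3)) i)) 2 μQ ≤
      (CG : ℝ≥0∞) ^ (1 / 2 : ℝ) := fun k i =>
    (hcol2 (Γ := fun z => G k z.1 z.2) (prod_mono Subset.rfl (subset_univ _)) i).trans
      (ENNReal.rpow_le_rpow (hGb k) (by norm_num))
  have hCtop : (CG : ℝ≥0∞) ^ (1 / 2 : ℝ) ≠ ⊤ := ENNReal.rpow_ne_top_of_nonneg (by norm_num) ENNReal.coe_ne_top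
  have hGumem : ∀ i, MemLp (fun z : ℝ × EuclideanSpace ℝ (Fin 3) => Gu z.1 z.2 (stdOrthonormalBasis ℝ (EuclideanSpace ℝ (Fin 3)) i)) 2 μQ :=
    fun i => ⟨hcolm hGum _, (hcol2 (Γ := fun z => Gu z.1 z.2) hSslab i).trans_lt
      (ENNReal.rpow_lt_top_of_nonneg (by norm_num) (hGub n).ne)⟩
  have hGkmem : ∀ k i, MemLp (fun z : ℝ × EuclideanSpace ℝ (Fin 3) => G k z.1 z.2 (stdOrthonormalBasis ℝ (EuclideanSpace ℝ (Fin 3)) i)) 2 μQ :=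
    fun k i => ⟨hcolm (hGm k) _, (hGcol k i).trans_lt hCtop.lt_top⟩
  -- weak convergence of the columns on the cylinder
  have hGwQ : ∀ (a : EuclideanSpace ℝ (Fin 3)) (h : ℝ × EuclideanSpace ℝ (Fin 3) → EuclideanSpace ℝ (Fin 3)), MemLp h 2 μQ →
      Tendsto (fun k => ∫ z, ⟪G k z.1 z.2 a, h z⟫ ∂μQ) atTop (𝓝 (∫ z, ⟪Gu z.1 z.2 a, h z⟫ ∂μQ)) := by
    intro a h hh
    set S' : Set (ℝ × EuclideanSpace ℝ (Fin 3)) := Ioo (-((n : ℝ) + 1)) ((n : ℝ) + 1) ×ˢ (univ : Set (EuclideanSpace ℝ (Fin 3))) with hS'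
    have hS'm : MeasurableSet S' := measurableSet_Ioo.prod MeasurableSet.univ
    have hres : (volume.restrict S').restrict S = μQ := by
      rw [Measure.restrict_restrict hSm, inter_eq_left.2 hSslab]
    have hh' : MemLp (S.indicator h) 2 (volume.restrict S') := by
      rw [memLp_indicator_iff_restrict hSm, hres]; exact hh
    have hind : ∀ (Γ : ℝ × EuclideanSpace ℝ (Fin 3) → EuclideanSpace ℝ (Fin 3) →L[ℝ] EuclideanSpace ℝ (Fin 3)),
        ∫ z in S', ⟪Γ z a, S.indicator h z⟫ = ∫ z, ⟪Γ z a, h z⟫ ∂μQ := by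
      intro Γ
      have h1 : (fun z => ⟪Γ z a, S.indicator h z⟫) = S.indicator fun z => ⟪Γ z a, h z⟫ := by
        funext z
        by_cases hz : z ∈ S
        · rw [indicator_of_mem hz, indicator_of_mem hz]
        · rw [indicator_of_notMem hz, indicator_of_notMem hz, inner_zero_right]
      rw [h1, setIntegral_indicator hSm, inter_eq_right.2 hSslab]
    have h := hGw n a (S.indicator h) hh'
    rw [← hS'] at h
    simp only [hind] at h
    exact h
  -- ## the seven pieces of the tested integrand on the cylinder, for data `(w, Γ, b)`
  have hwt : AEStronglyMeasurable (fun z : ℝ × EuclideanSpace ℝ (Fin 3) => timeDeriv f z.1 z.2) μQ := cft.aestronglyMeasurable.restrict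
  have hwf : AEStronglyMeasurable (fun z : ℝ × EuclideanSpace ℝ (Fin 3) => f z.1 z.2) μQ := cf.aestronglyMeasurable.restrict
  have hwD : AEStronglyMeasurable (fun z : ℝ × EuclideanSpace ℝ (Fin 3) => fderiv ℝ (f z.1) z.2) μQ := cDf.aestronglyMeasurable.restrict
  have he1 : ∀ i, ‖stdOrthonormalBasis ℝ (EuclideanSpace ℝ (Fin 3)) i‖ = 1 := fun i =>
    (stdOrthonormalBasis ℝ (EuclideanSpace ℝ (Fin 3))).orthonormal.1 i
  -- generic integrability facts
  have hinner : ∀ {a c : ℝ × EuclideanSpace ℝ (Fin 3) → EuclideanSpace ℝ (Fin 3)}, MemLp a 2 μQ → MemLp c 2 μQ →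
      Integrable (fun z => ⟪a z, c z⟫) μQ := fun {a c} ha hc =>
    (ha.norm.integrable_mul hc.norm).mono' (ha.1.inner hc.1) (Eventually.of_forall fun z => norm_inner_le_norm _ _)
  have hbdmem : ∀ {c : ℝ × EuclideanSpace ℝ (Fin 3) → EuclideanSpace ℝ (Fin 3)} {K : ℝ}, AEStronglyMeasurable c μQ →
      (∀ᵐ z ∂μQ, ‖c z‖ ≤ K) → MemLp c 2 μQ := fun {c K} hc hK => (memLp_top_of_bound hc K hK).mono_exponent le_top
  have hLmem : ∀ {a : ℝ × EuclideanSpace ℝ (Fin 3) → EuclideanSpace ℝ (Fin 3)}, MemLp a 2 μQ → MemLp (fun z => L z (a z)) 2 μQ :=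
    fun {a} ha => MemLp.of_le_mul (c := MD) ha (happ.comp_aestronglyMeasurable₂ hLm ha.1)
      (Eventually.of_forall fun z => (ContinuousLinearMap.le_opNorm _ _).trans (mul_le_mul_of_nonneg_right (hLM z) (norm_nonneg _)))
  -- the columns of the three partner fields
  have hRDf : ∀ i, MemLp (fun z : ℝ × EuclideanSpace ℝ (Fin 3) => fderiv ℝ (f z.1) z.2 (stdOrthonormalBasis ℝ (EuclideanSpace ℝ (Fin 3)) i)) 2 μQ :=
    fun i => hbdmem ((happ.comp_aestronglyMeasurable₂ hwD aestronglyMeasurable_const)) (Eventually.of_forall fun z =>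
      ((ContinuousLinearMap.le_opNorm _ _).trans (by rw [he1, mul_one]; exact hCDf z)))
  have hRy : ∀ i, MemLp (fun z : ℝ × EuclideanSpace ℝ (Fin 3) =>
      ((innerSL ℝ z.2).smulRight (f z.1 z.2)) (stdOrthonormalBasis ℝ (EuclideanSpace ℝ (Fin 3)) i)) 2 μQ := by
    intro i
    simp only [ContinuousLinearMap.smulRight_apply, innerSL_apply_apply]
    have hc : Continuous fun z : ℝ × EuclideanSpace ℝ (Fin 3) =>
        ⟪z.2, stdOrthonormalBasis ℝ (EuclideanSpace ℝ (Fin 3)) i⟫ • f z.1 z.2 :=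
      (continuous_snd.inner (𝕜 := ℝ) (continuous_const (y := stdOrthonormalBasis ℝ (EuclideanSpace ℝ (Fin 3)) i))).smul cf
    refine hbdmem hc.aestronglyMeasurable.restrict (K := Rf * Cf) ?_
    filter_upwards [ae_restrict_mem hSm] with z hz
    rw [norm_smul]
    refine mul_le_mul ?_ (hCf z) (norm_nonneg _) hRf0.le
    calc ‖⟪z.2, stdOrthonormalBasis ℝ (EuclideanSpace ℝ (Fin 3)) i⟫‖ ≤ ‖z.2‖ * ‖stdOrthonormalBasis ℝ (EuclideanSpace ℝ (Fin 3)) i‖ :=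
          norm_inner_le_norm _ _
      _ ≤ Rf := by rw [he1, mul_one]; exact (mem_ball_zero_iff.1 hz.2).le
  have hRb : ∀ {b : ℝ × EuclideanSpace ℝ (Fin 3) → EuclideanSpace ℝ (Fin 3)}, MemLp b 2 μQ → ∀ i,
      MemLp (fun z : ℝ × EuclideanSpace ℝ (Fin 3) =>
        ((innerSL ℝ (b z)).smulRight (f z.1 z.2)) (stdOrthonormalBasis ℝ (EuclideanSpace ℝ (Fin 3)) i)) 2 μQ := by
    intro b hb i
    simp only [ContinuousLinearMap.smulRight_apply, innerSL_apply_apply]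
    have hm : AEStronglyMeasurable (fun z : ℝ × EuclideanSpace ℝ (Fin 3) =>
        ⟪b z, stdOrthonormalBasis ℝ (EuclideanSpace ℝ (Fin 3)) i⟫ • f z.1 z.2) μQ :=
      (hb.1.inner (𝕜 := ℝ) (aestronglyMeasurable_const (b := stdOrthonormalBasis ℝ (EuclideanSpace ℝ (Fin 3)) i))).smul hwf
    refine MemLp.of_le_mul (c := Cf) hb hm (Eventually.of_forall fun z => ?_)
    rw [norm_smul]
    calc ‖⟪b z, stdOrthonormalBasis ℝ (EuclideanSpace ℝ (Fin 3)) i⟫‖ * ‖f z.1 z.2‖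
        ≤ (‖b z‖ * ‖stdOrthonormalBasis ℝ (EuclideanSpace ℝ (Fin 3)) i‖) * Cf :=
          mul_le_mul (norm_inner_le_norm _ _) (hCf z) (norm_nonneg _) (by positivity)
      _ = Cf * ‖b z‖ := by rw [he1, mul_one, mul_comm]
  -- ## the split of the tested integrand into seven integrals
  have hsplit : ∀ {w b : ℝ × EuclideanSpace ℝ (Fin 3) → EuclideanSpace ℝ (Fin 3)}
      {Γ : ℝ × EuclideanSpace ℝ (Fin 3) → EuclideanSpace ℝ (Fin 3) →L[ℝ] EuclideanSpace ℝ (Fin 3)},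
      MemLp w 2 μQ → MemLp b 2 μQ →
      (∀ i, MemLp (fun z => Γ z (stdOrthonormalBasis ℝ (EuclideanSpace ℝ (Fin 3)) i)) 2 μQ) →
      Integrable (fun z => ⟪w z, timeDeriv f z.1 z.2⟫ - frobeniusInner (Γ z) (fderiv ℝ (f z.1) z.2) + ⟪w z, f z.1 z.2⟫ +
          frobeniusInner (Γ z) ((innerSL ℝ z.2).smulRight (f z.1 z.2)) -
          frobeniusInner (Γ z) ((innerSL ℝ (b z)).smulRight (f z.1 z.2)) - ⟪f z.1 z.2, L z (w z)⟫ -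
          ⟪L z (W z.1 z.2), f z.1 z.2⟫) μQ ∧
      ∫ z, (⟪w z, timeDeriv f z.1 z.2⟫ - frobeniusInner (Γ z) (fderiv ℝ (f z.1) z.2) + ⟪w z, f z.1 z.2⟫ +
          frobeniusInner (Γ z) ((innerSL ℝ z.2).smulRight (f z.1 z.2)) -
          frobeniusInner (Γ z) ((innerSL ℝ (b z)).smulRight (f z.1 z.2)) - ⟪f z.1 z.2, L z (w z)⟫ -
          ⟪L z (W z.1 z.2), f z.1 z.2⟫) ∂μQ =
        (∫ z, ⟪w z, timeDeriv f z.1 z.2⟫ ∂μQ) - (∫ z, frobeniusInner (Γ z) (fderiv ℝ (f z.1) z.2) ∂μQ) +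
          (∫ z, ⟪w z, f z.1 z.2⟫ ∂μQ) + (∫ z, frobeniusInner (Γ z) ((innerSL ℝ z.2).smulRight (f z.1 z.2)) ∂μQ) -
          (∫ z, frobeniusInner (Γ z) ((innerSL ℝ (b z)).smulRight (f z.1 z.2)) ∂μQ) -
          (∫ z, ⟪f z.1 z.2, L z (w z)⟫ ∂μQ) - ∫ z, ⟪L z (W z.1 z.2), f z.1 z.2⟫ ∂μQ := by
    intro w b Γ hw hb hΓ
    have i1 : Integrable (fun z => ⟪w z, timeDeriv f z.1 z.2⟫) μQ := hinner hw (hbdmem hwt (Eventually.of_forall hCft))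
    have i2 : Integrable (fun z => frobeniusInner (Γ z) (fderiv ℝ (f z.1) z.2)) μQ :=
      integrable_frobeniusInner_of_columns (μ := μQ) (Γ := Γ) (R := fun z : ℝ × EuclideanSpace ℝ (Fin 3) => fderiv ℝ (f z.1) z.2) hΓ hRDf
    have i3 : Integrable (fun z => ⟪w z, f z.1 z.2⟫) μQ := hinner hw hfmem
    have i4 : Integrable (fun z => frobeniusInner (Γ z) ((innerSL ℝ z.2).smulRight (f z.1 z.2))) μQ :=
      integrable_frobeniusInner_of_columns (μ := μQ) (Γ := Γ) (R := fun z : ℝ × EuclideanSpace ℝ (Fin 3) => (innerSL ℝ z.2).smulRight (f z.1 z.2)) hΓ hRy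
    have i5 : Integrable (fun z => frobeniusInner (Γ z) ((innerSL ℝ (b z)).smulRight (f z.1 z.2))) μQ :=
      integrable_frobeniusInner_of_columns (μ := μQ) (Γ := Γ) (R := fun z : ℝ × EuclideanSpace ℝ (Fin 3) => (innerSL ℝ (b z)).smulRight (f z.1 z.2)) hΓ (hRb hb)
    have i6 : Integrable (fun z => ⟪f z.1 z.2, L z (w z)⟫) μQ := hinner hfmem (hLmem hw)
    have i7 : Integrable (fun z => ⟪L z (W z.1 z.2), f z.1 z.2⟫) μQ := hinner (hLmem hWmem) hfmem
    have i12 : Integrable (fun z => ⟪w z, timeDeriv f z.1 z.2⟫ - frobeniusInner (Γ z) (fderiv ℝ (f z.1) z.2)) μQ := i1.sub i2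
    have i123 : Integrable (fun z => ⟪w z, timeDeriv f z.1 z.2⟫ - frobeniusInner (Γ z) (fderiv ℝ (f z.1) z.2) + ⟪w z, f z.1 z.2⟫) μQ :=
      i12.add i3
    have i1234 : Integrable (fun z => ⟪w z, timeDeriv f z.1 z.2⟫ - frobeniusInner (Γ z) (fderiv ℝ (f z.1) z.2) + ⟪w z, f z.1 z.2⟫ +
        frobeniusInner (Γ z) ((innerSL ℝ z.2).smulRight (f z.1 z.2))) μQ := i123.add i4
    have i12345 : Integrable (fun z => ⟪w z, timeDeriv f z.1 z.2⟫ - frobeniusInner (Γ z) (fderiv ℝ (f z.1) z.2) + ⟪w z, f z.1 z.2⟫ +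
        frobeniusInner (Γ z) ((innerSL ℝ z.2).smulRight (f z.1 z.2)) -
        frobeniusInner (Γ z) ((innerSL ℝ (b z)).smulRight (f z.1 z.2))) μQ := i1234.sub i5
    have i123456 : Integrable (fun z => ⟪w z, timeDeriv f z.1 z.2⟫ - frobeniusInner (Γ z) (fderiv ℝ (f z.1) z.2) + ⟪w z, f z.1 z.2⟫ +
        frobeniusInner (Γ z) ((innerSL ℝ z.2).smulRight (f z.1 z.2)) -
        frobeniusInner (Γ z) ((innerSL ℝ (b z)).smulRight (f z.1 z.2)) - ⟪f z.1 z.2, L z (w z)⟫) μQ := i12345.sub i6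
    refine ⟨i123456.sub i7, ?_⟩
    rw [integral_sub i123456 i7, integral_sub i12345 i6, integral_sub i1234 i5, integral_add i123 i4,
      integral_add i12 i3, integral_sub i1 i2]
  -- ## the original integrand and its rewriting on the cylinder
  have hrewrite : ∀ (w b : ℝ × EuclideanSpace ℝ (Fin 3) → EuclideanSpace ℝ (Fin 3))
      (Γ : ℝ × EuclideanSpace ℝ (Fin 3) → EuclideanSpace ℝ (Fin 3) →L[ℝ] EuclideanSpace ℝ (Fin 3)),
      (fun z : ℝ × EuclideanSpace ℝ (Fin 3) => ⟪w z, timeDeriv f z.1 z.2⟫ - frobeniusInner (Γ z) (fderiv ℝ (f z.1) z.2) +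
        ⟪w z + Γ z z.2 - Γ z (b z) - fderiv ℝ (W z.1) z.2 (w z) - fderiv ℝ (W z.1) z.2 (W z.1 z.2), f z.1 z.2⟫) =ᵐ[μQ]
      fun z => ⟪w z, timeDeriv f z.1 z.2⟫ - frobeniusInner (Γ z) (fderiv ℝ (f z.1) z.2) + ⟪w z, f z.1 z.2⟫ +
          frobeniusInner (Γ z) ((innerSL ℝ z.2).smulRight (f z.1 z.2)) -
          frobeniusInner (Γ z) ((innerSL ℝ (b z)).smulRight (f z.1 z.2)) - ⟪f z.1 z.2, L z (w z)⟫ -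
          ⟪L z (W z.1 z.2), f z.1 z.2⟫ := by
    intro w b Γ
    filter_upwards [hLae] with z hz
    rw [hz, ← inner_clm_apply_eq_frobeniusInner_smulRight, ← inner_clm_apply_eq_frobeniusInner_smulRight,
      real_inner_comm (fderiv ℝ (W z.1) z.2 (w z))]
    simp only [inner_sub_left, inner_add_left]
    ring
  -- vanishing of the original integrand off the ball
  have hvanish : ∀ (w b : ℝ × EuclideanSpace ℝ (Fin 3) → EuclideanSpace ℝ (Fin 3))
      (Γ : ℝ × EuclideanSpace ℝ (Fin 3) → EuclideanSpace ℝ (Fin 3) →L[ℝ] EuclideanSpace ℝ (Fin 3)) (z : ℝ × EuclideanSpace ℝ (Fin 3)),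
      z.2 ∉ B → ⟪w z, timeDeriv f z.1 z.2⟫ - frobeniusInner (Γ z) (fderiv ℝ (f z.1) z.2) +
        ⟪w z + Γ z z.2 - Γ z (b z) - fderiv ℝ (W z.1) z.2 (w z) - fderiv ℝ (W z.1) z.2 (W z.1 z.2), f z.1 z.2⟫ = 0 := by
    intro w b Γ z hz
    obtain ⟨h1, h2, h3⟩ := hRf z.1 z.2 hz
    rw [h1, h2, h3, inner_zero_right, inner_zero_right, frobeniusInner_zero_right]
    ring
  -- ## from the hypothesis to the cylinder: Fubini
  have hprodI : (volume.restrict (I ×ˢ (univ : Set (EuclideanSpace ℝ (Fin 3)))) : Measure (ℝ × EuclideanSpace ℝ (Fin 3))) =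
      ((volume : Measure ℝ).restrict I).prod (volume : Measure (EuclideanSpace ℝ (Fin 3))) := by
    rw [FunctionSpaces.AubinLions.volume_restrict_prod, Measure.restrict_univ]
  have hSsub : S ⊆ I ×ˢ (univ : Set (EuclideanSpace ℝ (Fin 3))) := prod_mono Subset.rfl (subset_univ _)
  have hIum : MeasurableSet (I ×ˢ (univ : Set (EuclideanSpace ℝ (Fin 3)))) := measurableSet_Ioo.prod MeasurableSet.univ
  -- for data with the original integrand integrable on the cylinder: `∫_I ∫_y O = ∫_S O`
  have hfubini : ∀ {O : ℝ → EuclideanSpace ℝ (Fin 3) → ℝ}, Integrable (fun z => O z.1 z.2) μQ →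
      (∀ z : ℝ × EuclideanSpace ℝ (Fin 3), z.2 ∉ B → O z.1 z.2 = 0) →
      Integrable (fun s => ∫ y, O s y) ((volume : Measure ℝ).restrict I) ∧
      (∀ᵐ s ∂((volume : Measure ℝ).restrict I), Integrable (O s) (volume : Measure (EuclideanSpace ℝ (Fin 3)))) ∧
      ∫ s in I, ∫ y, O s y = ∫ z, O z.1 z.2 ∂μQ := by
    intro O hO hOz
    have h1 : IntegrableOn (fun z : ℝ × EuclideanSpace ℝ (Fin 3) => O z.1 z.2) (I ×ˢ (univ : Set (EuclideanSpace ℝ (Fin 3)))) volume :=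
      IntegrableOn.of_forall_sdiff_eq_zero hO hIum fun z hz => hOz z fun h => hz.2 ⟨hz.1.1, h⟩
    have h2 : Integrable (uncurry O) (((volume : Measure ℝ).restrict I).prod (volume : Measure (EuclideanSpace ℝ (Fin 3)))) := by
      rw [← hprodI]; exact h1
    refine ⟨h2.integral_prod_left, h2.prod_right_ae, ?_⟩
    rw [integral_integral h2, ← hprodI]
    exact setIntegral_eq_of_subset_of_forall_sdiff_eq_zero hIum hSsub fun z hz => hOz z fun h => hz.2 ⟨hz.1.1, h⟩
  -- the profile pairing is integrable on `(0, T)`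
  have cWt : Continuous fun z : ℝ × EuclideanSpace ℝ (Fin 3) => timeDeriv W z.1 z.2 := continuous_timeDeriv_of_contDiff_one hW
  have cDWy : Continuous fun z : ℝ × EuclideanSpace ℝ (Fin 3) => fderiv ℝ (W z.1) z.2 z.2 := happ.comp (cDW.prodMk continuous_snd)
  have cfrob : Continuous fun z : ℝ × EuclideanSpace ℝ (Fin 3) => frobeniusInner (fderiv ℝ (W z.1) z.2) (fderiv ℝ (f z.1) z.2) := by
    simp only [frobeniusInner]
    refine continuous_finsetSum _ fun i _ => ?_
    exact (cDW.clm_apply continuous_const).inner (cDf.clm_apply continuous_const)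
  have hLp : IntegrableOn (fun s => lerayPairing W s (f s)) I (volume : Measure ℝ) := by
    have c₁ : Continuous fun z : ℝ × EuclideanSpace ℝ (Fin 3) =>
        ⟪timeDeriv W z.1 z.2 - W z.1 z.2 - fderiv ℝ (W z.1) z.2 z.2, f z.1 z.2⟫ +
          frobeniusInner (fderiv ℝ (W z.1) z.2) (fderiv ℝ (f z.1) z.2) := (((cWt.sub cW).sub cDWy).inner cf).add cfrob
    have hz₁ : ∀ z : ℝ × EuclideanSpace ℝ (Fin 3), z.2 ∉ B →
        ⟪timeDeriv W z.1 z.2 - W z.1 z.2 - fderiv ℝ (W z.1) z.2 z.2, f z.1 z.2⟫ +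
          frobeniusInner (fderiv ℝ (W z.1) z.2) (fderiv ℝ (f z.1) z.2) = 0 := by
      intro z hz
      obtain ⟨h1, h2, -⟩ := hRf z.1 z.2 hz
      rw [h1, h2, inner_zero_right, frobeniusInner_zero_right, add_zero]
    exact integrableOn_integral_slice c₁ hz₁ 0 T
  -- the `W`-terms are integrable on `(0, T)`
  have hΛ : IntegrableOn (fun s => ∫ y, (⟪W s y, timeDeriv f s y⟫ - frobeniusInner (fderiv ℝ (W s) y) (fderiv ℝ (f s) y) +
      ⟪W s y + fderiv ℝ (W s) y y, f s y⟫)) I (volume : Measure ℝ) := by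
    have c₂ : Continuous fun z : ℝ × EuclideanSpace ℝ (Fin 3) =>
        ⟪W z.1 z.2, timeDeriv f z.1 z.2⟫ - frobeniusInner (fderiv ℝ (W z.1) z.2) (fderiv ℝ (f z.1) z.2) +
          ⟪W z.1 z.2 + fderiv ℝ (W z.1) z.2 z.2, f z.1 z.2⟫ := ((cW.inner cft).sub cfrob).add ((cW.add cDWy).inner cf)
    have hz₂ : ∀ z : ℝ × EuclideanSpace ℝ (Fin 3), z.2 ∉ B →
        ⟪W z.1 z.2, timeDeriv f z.1 z.2⟫ - frobeniusInner (fderiv ℝ (W z.1) z.2) (fderiv ℝ (f z.1) z.2) +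
          ⟪W z.1 z.2 + fderiv ℝ (W z.1) z.2 z.2, f z.1 z.2⟫ = 0 := by
      intro z hz
      obtain ⟨h1, h2, h3⟩ := hRf z.1 z.2 hz
      rw [h1, h2, h3, inner_zero_right, inner_zero_right, frobeniusInner_zero_right, sub_zero, add_zero]
    exact integrableOn_integral_slice c₂ hz₂ 0 T
  have hΛi : ∀ s, Integrable (fun y => ⟪W s y, timeDeriv f s y⟫ - frobeniusInner (fderiv ℝ (W s) y) (fderiv ℝ (f s) y) +
      ⟪W s y + fderiv ℝ (W s) y y, f s y⟫) (volume : Measure (EuclideanSpace ℝ (Fin 3))) := by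
    intro s
    have c₂ : Continuous fun z : ℝ × EuclideanSpace ℝ (Fin 3) =>
        ⟪W z.1 z.2, timeDeriv f z.1 z.2⟫ - frobeniusInner (fderiv ℝ (W z.1) z.2) (fderiv ℝ (f z.1) z.2) +
          ⟪W z.1 z.2 + fderiv ℝ (W z.1) z.2 z.2, f z.1 z.2⟫ := ((cW.inner cft).sub cfrob).add ((cW.add cDWy).inner cf)
    have hz₂ : ∀ z : ℝ × EuclideanSpace ℝ (Fin 3), z.2 ∉ B →
        ⟪W z.1 z.2, timeDeriv f z.1 z.2⟫ - frobeniusInner (fderiv ℝ (W z.1) z.2) (fderiv ℝ (f z.1) z.2) +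
          ⟪W z.1 z.2 + fderiv ℝ (W z.1) z.2 z.2, f z.1 z.2⟫ = 0 := by
      intro z hz
      obtain ⟨h1, h2, h3⟩ := hRf z.1 z.2 hz
      rw [h1, h2, h3, inner_zero_right, inner_zero_right, frobeniusInner_zero_right, sub_zero, add_zero]
    exact integrable_slice_of_continuous_of_ball c₂ hz₂ s
  -- ## the identity for each `k` on the cylinder
  have hOk_int : ∀ k, Integrable (fun z : ℝ × EuclideanSpace ℝ (Fin 3) =>
      ⟪U k z.1 z.2, timeDeriv f z.1 z.2⟫ - frobeniusInner (G k z.1 z.2) (fderiv ℝ (f z.1) z.2) +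
        ⟪U k z.1 z.2 + G k z.1 z.2 z.2 - G k z.1 z.2 (W z.1 z.2 + mollify η ε (U k) z.1 z.2) -
          fderiv ℝ (W z.1) z.2 (U k z.1 z.2) - fderiv ℝ (W z.1) z.2 (W z.1 z.2), f z.1 z.2⟫) μQ := fun k =>
    ((hsplit (hUmem k) (hbkmem k) (hGkmem k)).1.congr (hrewrite (fun z => U k z.1 z.2)
      (fun z => W z.1 z.2 + mollify η ε (U k) z.1 z.2) (fun z => G k z.1 z.2)).symm)
  have hk : ∀ᶠ k in atTop, (∫ z, ⟪U k z.1 z.2, timeDeriv f z.1 z.2⟫ ∂μQ) -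
      (∫ z, frobeniusInner (G k z.1 z.2) (fderiv ℝ (f z.1) z.2) ∂μQ) +
      (∫ z, ⟪U k z.1 z.2, f z.1 z.2⟫ ∂μQ) +
      (∫ z, frobeniusInner (G k z.1 z.2) ((innerSL ℝ z.2).smulRight (f z.1 z.2)) ∂μQ) -
      (∫ z, frobeniusInner (G k z.1 z.2) ((innerSL ℝ (W z.1 z.2 + mollify η ε (U k) z.1 z.2)).smulRight (f z.1 z.2)) ∂μQ) -
      (∫ z, ⟪f z.1 z.2, L z (U k z.1 z.2)⟫ ∂μQ) - (∫ z, ⟪L z (W z.1 z.2), f z.1 z.2⟫ ∂μQ) =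
      ∫ s in I, lerayPairing W s (f s) := by
    filter_upwards [hid] with k hidk
    obtain ⟨ha, -, hfub⟩ := hfubini (O := fun s y => ⟪U k s y, timeDeriv f s y⟫ - frobeniusInner (G k s y) (fderiv ℝ (f s) y) +
        ⟪U k s y + G k s y y - G k s y (W s y + mollify η ε (U k) s y) -
          fderiv ℝ (W s) y (U k s y) - fderiv ℝ (W s) y (W s y), f s y⟫) (hOk_int k)
      (fun z hz => hvanish (fun z => U k z.1 z.2) (fun z => W z.1 z.2 + mollify η ε (U k) z.1 z.2) (fun z => G k z.1 z.2) z hz)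
    have key : ∫ s in I, ((∫ y, (⟪U k s y, timeDeriv f s y⟫ - frobeniusInner (G k s y) (fderiv ℝ (f s) y) +
        ⟪U k s y + G k s y y - G k s y (W s y + mollify η ε (U k) s y) -
          fderiv ℝ (W s) y (U k s y) - fderiv ℝ (W s) y (W s y), f s y⟫)) - lerayPairing W s (f s)) = 0 := hidk
    rw [integral_sub ha hLp, sub_eq_zero, hfub] at key
    rw [← key, ← (hsplit (hUmem k) (hbkmem k) (hGkmem k)).2]
    exact integral_congr_ae (hrewrite (fun z => U k z.1 z.2) (fun z => W z.1 z.2 + mollify η ε (U k) z.1 z.2)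
      (fun z => G k z.1 z.2)).symm
  -- ## the limits of the seven pieces
  have hl1 : Tendsto (fun k => ∫ z, ⟪U k z.1 z.2, timeDeriv f z.1 z.2⟫ ∂μQ) atTop (𝓝 (∫ z, ⟪Ul z.1 z.2, timeDeriv f z.1 z.2⟫ ∂μQ)) :=
    tendsto_integral_inner_of_tendsto_eLpNorm_two_bdd hUmem hUlmem hconvU hwt hCft0 hCft
  have hl2 : Tendsto (fun k => ∫ z, frobeniusInner (G k z.1 z.2) (fderiv ℝ (f z.1) z.2) ∂μQ) atTop
      (𝓝 (∫ z, frobeniusInner (Gu z.1 z.2) (fderiv ℝ (f z.1) z.2) ∂μQ)) :=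
    tendsto_integral_frobeniusInner (μ := μQ) (M := (CG : ℝ≥0∞) ^ (1 / 2 : ℝ))
      (Γ := fun (k : ℕ) (z : ℝ × EuclideanSpace ℝ (Fin 3)) => G k z.1 z.2)
      (Γ₀ := fun z : ℝ × EuclideanSpace ℝ (Fin 3) => Gu z.1 z.2)
      (R := fun (_ : ℕ) (z : ℝ × EuclideanSpace ℝ (Fin 3)) => fderiv ℝ (f z.1) z.2)
      (R₀ := fun z : ℝ × EuclideanSpace ℝ (Fin 3) => fderiv ℝ (f z.1) z.2)
      (fun k i => hcolm (hGm k) (stdOrthonormalBasis ℝ (EuclideanSpace ℝ (Fin 3)) i)) hCtop hGcol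
      (fun i h hh => hGwQ (stdOrthonormalBasis ℝ (EuclideanSpace ℝ (Fin 3)) i) h hh) (fun _ i => hRDf i) hRDf
      (fun i => by simp only [sub_self, eLpNorm_zero]; exact tendsto_const_nhds) hGumem
  have hl3 : Tendsto (fun k => ∫ z, ⟪U k z.1 z.2, f z.1 z.2⟫ ∂μQ) atTop (𝓝 (∫ z, ⟪Ul z.1 z.2, f z.1 z.2⟫ ∂μQ)) :=
    tendsto_integral_inner_of_tendsto_eLpNorm_two_bdd hUmem hUlmem hconvU hwf hCf0 hCf
  have hl4 : Tendsto (fun k => ∫ z, frobeniusInner (G k z.1 z.2) ((innerSL ℝ z.2).smulRight (f z.1 z.2)) ∂μQ) atTop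
      (𝓝 (∫ z, frobeniusInner (Gu z.1 z.2) ((innerSL ℝ z.2).smulRight (f z.1 z.2)) ∂μQ)) :=
    tendsto_integral_frobeniusInner (μ := μQ) (M := (CG : ℝ≥0∞) ^ (1 / 2 : ℝ))
      (Γ := fun (k : ℕ) (z : ℝ × EuclideanSpace ℝ (Fin 3)) => G k z.1 z.2)
      (Γ₀ := fun z : ℝ × EuclideanSpace ℝ (Fin 3) => Gu z.1 z.2)
      (R := fun (_ : ℕ) (z : ℝ × EuclideanSpace ℝ (Fin 3)) => (innerSL ℝ z.2).smulRight (f z.1 z.2))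
      (R₀ := fun z : ℝ × EuclideanSpace ℝ (Fin 3) => (innerSL ℝ z.2).smulRight (f z.1 z.2))
      (fun k i => hcolm (hGm k) (stdOrthonormalBasis ℝ (EuclideanSpace ℝ (Fin 3)) i)) hCtop hGcol
      (fun i h hh => hGwQ (stdOrthonormalBasis ℝ (EuclideanSpace ℝ (Fin 3)) i) h hh) (fun _ i => hRy i) hRy
      (fun i => by simp only [sub_self, eLpNorm_zero]; exact tendsto_const_nhds) hGumem
  have hl5 : Tendsto (fun k => ∫ z, frobeniusInner (G k z.1 z.2)
      ((innerSL ℝ (W z.1 z.2 + mollify η ε (U k) z.1 z.2)).smulRight (f z.1 z.2)) ∂μQ) atTop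
      (𝓝 (∫ z, frobeniusInner (Gu z.1 z.2) ((innerSL ℝ (W z.1 z.2 + mollify η ε Ul z.1 z.2)).smulRight (f z.1 z.2)) ∂μQ)) := by
    refine tendsto_integral_frobeniusInner (μ := μQ) (M := (CG : ℝ≥0∞) ^ (1 / 2 : ℝ))
      (Γ := fun (k : ℕ) (z : ℝ × EuclideanSpace ℝ (Fin 3)) => G k z.1 z.2)
      (Γ₀ := fun z : ℝ × EuclideanSpace ℝ (Fin 3) => Gu z.1 z.2)
      (R := fun (k : ℕ) (z : ℝ × EuclideanSpace ℝ (Fin 3)) => (innerSL ℝ (W z.1 z.2 + mollify η ε (U k) z.1 z.2)).smulRight (f z.1 z.2))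
      (R₀ := fun z : ℝ × EuclideanSpace ℝ (Fin 3) => (innerSL ℝ (W z.1 z.2 + mollify η ε Ul z.1 z.2)).smulRight (f z.1 z.2))
      (fun k i => hcolm (hGm k) (stdOrthonormalBasis ℝ (EuclideanSpace ℝ (Fin 3)) i)) hCtop hGcol
      (fun i h hh => hGwQ (stdOrthonormalBasis ℝ (EuclideanSpace ℝ (Fin 3)) i) h hh) (fun k i => hRb (hbkmem k) i) (hRb hbmem) ?_ hGumem
    intro i
    have hbd : ∀ k, eLpNorm ((fun z : ℝ × EuclideanSpace ℝ (Fin 3) =>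
        ((innerSL ℝ (W z.1 z.2 + mollify η ε (U k) z.1 z.2)).smulRight (f z.1 z.2)) (stdOrthonormalBasis ℝ (EuclideanSpace ℝ (Fin 3)) i)) -
        fun z => ((innerSL ℝ (W z.1 z.2 + mollify η ε Ul z.1 z.2)).smulRight (f z.1 z.2)) (stdOrthonormalBasis ℝ (EuclideanSpace ℝ (Fin 3)) i)) 2 μQ ≤
        ENNReal.ofReal Cf * eLpNorm ((fun z : ℝ × EuclideanSpace ℝ (Fin 3) => W z.1 z.2 + mollify η ε (U k) z.1 z.2) -
          fun z => W z.1 z.2 + mollify η ε Ul z.1 z.2) 2 μQ := by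
      intro k
      refine eLpNorm_le_mul_eLpNorm_of_ae_le_mul (Eventually.of_forall fun z => ?_) 2
      simp only [Pi.sub_apply, ContinuousLinearMap.smulRight_apply, innerSL_apply_apply, ← sub_smul, ← inner_sub_left]
      rw [norm_smul]
      calc ‖⟪W z.1 z.2 + mollify η ε (U k) z.1 z.2 - (W z.1 z.2 + mollify η ε Ul z.1 z.2), stdOrthonormalBasis ℝ (EuclideanSpace ℝ (Fin 3)) i⟫‖ * ‖f z.1 z.2‖
          ≤ (‖W z.1 z.2 + mollify η ε (U k) z.1 z.2 - (W z.1 z.2 + mollify η ε Ul z.1 z.2)‖ * ‖stdOrthonormalBasis ℝ (EuclideanSpace ℝ (Fin 3)) i‖) * Cf :=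
            mul_le_mul (norm_inner_le_norm _ _) (hCf z) (norm_nonneg _) (by positivity)
        _ = Cf * ‖W z.1 z.2 + mollify η ε (U k) z.1 z.2 - (W z.1 z.2 + mollify η ε Ul z.1 z.2)‖ := by rw [he1, mul_one, mul_comm]
    have hlim : Tendsto (fun k => ENNReal.ofReal Cf * eLpNorm ((fun z : ℝ × EuclideanSpace ℝ (Fin 3) => W z.1 z.2 + mollify η ε (U k) z.1 z.2) -
        fun z => W z.1 z.2 + mollify η ε Ul z.1 z.2) 2 μQ) atTop (𝓝 0) := by
      have h := ENNReal.Tendsto.const_mul hconvb (a := ENNReal.ofReal Cf) (Or.inr ENNReal.ofReal_ne_top)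
      rwa [mul_zero] at h
    exact tendsto_of_tendsto_of_tendsto_of_le_of_le tendsto_const_nhds hlim (fun _ => zero_le) hbd
  have hl6 : Tendsto (fun k => ∫ z, ⟪f z.1 z.2, L z (U k z.1 z.2)⟫ ∂μQ) atTop (𝓝 (∫ z, ⟪f z.1 z.2, L z (Ul z.1 z.2)⟫ ∂μQ)) :=
    tendsto_integral_inner_clm_apply₂ (μ := μQ) (f := fun (_ : ℕ) (z : ℝ × EuclideanSpace ℝ (Fin 3)) => f z.1 z.2)
      (f₀ := fun z : ℝ × EuclideanSpace ℝ (Fin 3) => f z.1 z.2)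
      (g := fun (k : ℕ) (z : ℝ × EuclideanSpace ℝ (Fin 3)) => U k z.1 z.2) (g₀ := fun z : ℝ × EuclideanSpace ℝ (Fin 3) => Ul z.1 z.2)
      (L := L) (fun _ => hfmem) hfmem hUmem hUlmem hconvf hconvU hLm hMD0 hLM
  have hlim := (((((hl1.sub hl2).add hl3).add hl4).sub hl5).sub hl6).sub
    (tendsto_const_nhds (x := ∫ z, ⟪L z (W z.1 z.2), f z.1 z.2⟫ ∂μQ))
  have hlim' := hlim.congr' hk
  have hlimit_eq := tendsto_nhds_unique tendsto_const_nhds hlim'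
  -- `∫_S O_∞ = ∫_I ⟨LW, f⟩`
  have hO_int : Integrable (fun z : ℝ × EuclideanSpace ℝ (Fin 3) =>
      ⟪Ul z.1 z.2, timeDeriv f z.1 z.2⟫ - frobeniusInner (Gu z.1 z.2) (fderiv ℝ (f z.1) z.2) +
        ⟪Ul z.1 z.2 + Gu z.1 z.2 z.2 - Gu z.1 z.2 (W z.1 z.2 + mollify η ε Ul z.1 z.2) -
          fderiv ℝ (W z.1) z.2 (Ul z.1 z.2) - fderiv ℝ (W z.1) z.2 (W z.1 z.2), f z.1 z.2⟫) μQ :=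
    ((hsplit hUlmem hbmem hGumem).1.congr (hrewrite (fun z => Ul z.1 z.2)
      (fun z => W z.1 z.2 + mollify η ε Ul z.1 z.2) (fun z => Gu z.1 z.2)).symm)
  have hO_eq : ∫ z, (⟪Ul z.1 z.2, timeDeriv f z.1 z.2⟫ - frobeniusInner (Gu z.1 z.2) (fderiv ℝ (f z.1) z.2) +
        ⟪Ul z.1 z.2 + Gu z.1 z.2 z.2 - Gu z.1 z.2 (W z.1 z.2 + mollify η ε Ul z.1 z.2) -
          fderiv ℝ (W z.1) z.2 (Ul z.1 z.2) - fderiv ℝ (W z.1) z.2 (W z.1 z.2), f z.1 z.2⟫) ∂μQ =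
      ∫ s in I, lerayPairing W s (f s) := by
    rw [integral_congr_ae (hrewrite (fun z => Ul z.1 z.2) (fun z => W z.1 z.2 + mollify η ε Ul z.1 z.2)
      (fun z => Gu z.1 z.2)), (hsplit hUlmem hbmem hGumem).2]
    exact hlimit_eq.symm
  obtain ⟨ha, -, hfub⟩ := hfubini (O := fun s y => ⟪Ul s y, timeDeriv f s y⟫ -
      frobeniusInner (Gu s y) (fderiv ℝ (f s) y) +
      ⟪Ul s y + Gu s y y - Gu s y (W s y + mollify η ε Ul s y) - fderiv ℝ (W s) y (Ul s y) -
        fderiv ℝ (W s) y (W s y), f s y⟫) hO_int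
    (fun z hz => hvanish (fun z => Ul z.1 z.2) (fun z => W z.1 z.2 + mollify η ε Ul z.1 z.2)
      (fun z => Gu z.1 z.2) z hz)
  rw [integral_sub ha hLp, hfub, hO_eq, sub_self]

end GalerkinWeakFormLimit

end BradshawTsai2017

end Literature.Analysis.FluidPDE

end
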